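import Summits.CriticalPhenomena.CardyFormulaZ2.Theorems.HalfPlaneMarkDensityLaw.Negative.RatioTemplate

/-!
# `HalfPlaneMarkDensityLaw` (crux stmt-CriticalPhenomena-5661), line `Sketch`:
# stub D, the difference-quotient lemma `stub_densityFromIncrements` (pure real analysis)

If the right-window partial sums `Σ_{⌊xn⌋ < k ≤ ⌊yn⌋} g n k` converge to the increments `G y − G x`
for `y ∈ (x, x + δ₀)`, `g n` is Lipschitz at scale `n⁻²` on the lattice window
`[⌊xn⌋, ⌊(x+δ₀)n⌋]`, and `G` is differentiable at `x` with derivative `ρ`, then the rescaled point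
mass converges: `n · g n ⌊xn⌋ → ρ`.

Proof: for `y = x + t`, with `N_n = ⌊yn⌋ − ⌊xn⌋` and `S_n` the window sum, the Lipschitz bound gives
`|S_n − N_n · g n ⌊xn⌋| ≤ C N_n² / n²`, whence `|n · g n ⌊xn⌋ − S_n / (N_n/n)| ≤ C · N_n / n ≤ 2Ct`
eventually (`N_n / n → t`, tree lemma `tendsto_floor_window_div`); `S_n / (N_n/n) → (G y − G x)/t`,
and `(G (x+t) − G x)/t → ρ` as `t ↓ 0` (`HasDerivAt.tendsto_slope_zero_right`); choose `t` small.
-/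

noncomputable section

namespace Summit.CriticalPhenomena.CardyFormulaZ2.Cruxes.HalfPlaneMarkDensityLaw.SketchLine

open MeasureTheory Filter Set
open scoped Topology
open Summit.CriticalPhenomena.CardyFormulaZ2.Theorems.HalfPlaneMarkDensityLaw.Negative

/-- Finite-sum bookkeeping: if `|a i − a₀| ≤ c · (i+1)` for `i < N` with `c ≥ 0`, then
`|Σ_{i<N} a i − N · a₀| ≤ c · N²`. [folklore] -/
private lemma abs_sum_range_sub_mul_le {a : ℕ → ℝ} {a₀ c : ℝ} {N : ℕ} (hc : 0 ≤ c)
    (h : ∀ i < N, |a i - a₀| ≤ c * (i + 1)) :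
    |∑ i ∈ Finset.range N, a i - N * a₀| ≤ c * (N : ℝ) ^ 2 := by
  have hrepr : ∑ i ∈ Finset.range N, a i - N * a₀ = ∑ i ∈ Finset.range N, (a i - a₀) := by
    rw [Finset.sum_sub_distrib, Finset.sum_const, Finset.card_range, nsmul_eq_mul]
  rw [hrepr]
  refine (Finset.abs_sum_le_sum_abs _ _).trans ?_
  have hterm : ∀ i ∈ Finset.range N, |a i - a₀| ≤ c * N := by
    intro i hi
    rw [Finset.mem_range] at hi
    refine (h i hi).trans ?_
    have hi' : (i : ℝ) + 1 ≤ N := by exact_mod_cast hi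
    exact mul_le_mul_of_nonneg_left hi' hc
  refine (Finset.sum_le_sum hterm).trans ?_
  rw [Finset.sum_const, Finset.card_range, nsmul_eq_mul]
  exact le_of_eq (by ring)

/-- STUB D (pure real analysis, a difference-quotient lemma): if the right-window partial sums of
`g n` converge to increments of `G`, `g n` is Lipschitz at scale `n⁻²` on the window, and `G` is
differentiable at `x`, then `n · g n ⌊xn⌋ → G'(x)`. [folklore] -/
theorem stub_densityFromIncrements :
    ∀ (g : ℕ → ℤ → ℝ) (G : ℝ → ℝ) (x ρ δ₀ C : ℝ), 0 < δ₀ →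
      (∀ y : ℝ, x < y → y < x + δ₀ →
        Tendsto (fun n : ℕ ↦ ∑ i ∈ Finset.range (⌊y * n⌋ - ⌊x * n⌋).toNat, g n (⌊x * n⌋ + 1 + i))
          atTop (𝓝 (G y - G x))) →
      (∀ n : ℕ, 1 ≤ n → ∀ k k' : ℤ, ⌊x * n⌋ ≤ k → k ≤ k' → k' ≤ ⌊(x + δ₀) * n⌋ →
        |g n k' - g n k| ≤ C * (k' - k) / (n : ℝ) ^ 2) →
      HasDerivAt G ρ x →
      Tendsto (fun n : ℕ ↦ (n : ℝ) * g n ⌊x * n⌋) atTop (𝓝 ρ) := by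
  intro g G x ρ δ₀ C hδ₀ hcdf hlip0 hderiv
  -- WLOG the Lipschitz constant is nonnegative
  set C' : ℝ := max C 0 with hC'
  have hC'0 : 0 ≤ C' := le_max_right _ _
  have hlip : ∀ n : ℕ, 1 ≤ n → ∀ k k' : ℤ, ⌊x * n⌋ ≤ k → k ≤ k' → k' ≤ ⌊(x + δ₀) * n⌋ →
      |g n k' - g n k| ≤ C' * (k' - k) / (n : ℝ) ^ 2 := by
    intro n hn k k' h1 h2 h3
    refine (hlip0 n hn k k' h1 h2 h3).trans ?_
    have hkk : (k : ℝ) ≤ k' := by exact_mod_cast h2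
    rw [mul_div_assoc, mul_div_assoc]
    exact mul_le_mul_of_nonneg_right (le_max_left C 0)
      (div_nonneg (sub_nonneg.2 hkk) (by positivity))
  -- the slope of `G` to the right of `x`
  have hslope : Tendsto (fun t : ℝ ↦ t⁻¹ * (G (x + t) - G x)) (𝓝[>] 0) (𝓝 ρ) := by
    simpa only [smul_eq_mul] using hderiv.tendsto_slope_zero_right
  rw [Metric.tendsto_atTop]
  intro τ hτ
  -- choice of the window width `t`
  have hsl : ∀ᶠ t : ℝ in 𝓝[>] 0, |t⁻¹ * (G (x + t) - G x) - ρ| < τ / 4 := by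
    have := (Metric.tendsto_nhds.1 hslope) (τ / 4) (by positivity)
    simpa only [Real.dist_eq] using this
  have hK : 0 < min δ₀ (τ / (4 * C' + 1)) := lt_min hδ₀ (by positivity)
  have hI : ∀ᶠ t : ℝ in 𝓝[>] 0, t ∈ Ioo (0 : ℝ) (min δ₀ (τ / (4 * C' + 1))) := Ioo_mem_nhdsGT hK
  obtain ⟨t, ⟨ht0, htK⟩, htsl⟩ := (hI.and hsl).exists
  have htδ₀ : t < δ₀ := htK.trans_le (min_le_left _ _)
  have htτ : t < τ / (4 * C' + 1) := htK.trans_le (min_le_right _ _)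
  have htτ' : 4 * C' * t ≤ τ := by
    have h := (lt_div_iff₀ (by positivity : (0 : ℝ) < 4 * C' + 1)).1 htτ
    nlinarith
  rw [inv_mul_eq_div] at htsl
  -- the window data
  set M : ℕ → ℕ := fun n ↦ (⌊(x + t) * n⌋ - ⌊x * n⌋).toNat with hM
  have hMint : ∀ n : ℕ, ((M n : ℕ) : ℤ) = ⌊(x + t) * n⌋ - ⌊x * n⌋ := by
    intro n; rw [hM, Int.toNat_of_nonneg]
    exact sub_nonneg.2 (Int.floor_le_floor
      (mul_le_mul_of_nonneg_right (by linarith) (Nat.cast_nonneg _)))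
  have hMlim : Tendsto (fun n : ℕ ↦ (M n : ℝ) / n) atTop (𝓝 t) := by
    refine (tendsto_floor_window_div (x := x) ht0.le).congr fun n ↦ ?_
    rw [← hMint n, Int.cast_natCast]
  have hSlim : Tendsto (fun n : ℕ ↦ ∑ i ∈ Finset.range (M n), g n (⌊x * n⌋ + 1 + i)) atTop
      (𝓝 (G (x + t) - G x)) := hcdf (x + t) (by linarith) (by linarith)
  have hq : Tendsto
      (fun n : ℕ ↦ (∑ i ∈ Finset.range (M n), g n (⌊x * n⌋ + 1 + i)) / ((M n : ℝ) / n))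
      atTop (𝓝 ((G (x + t) - G x) / t)) := hSlim.div hMlim ht0.ne'
  have hq_ev : ∀ᶠ n : ℕ in atTop,
      |(∑ i ∈ Finset.range (M n), g n (⌊x * n⌋ + 1 + i)) / ((M n : ℝ) / n) - (G (x + t) - G x) / t|
        < τ / 4 := by
    have := (Metric.tendsto_nhds.1 hq) (τ / 4) (by positivity)
    simpa only [Real.dist_eq] using this
  have hMpos : ∀ᶠ n : ℕ in atTop, t / 2 < (M n : ℝ) / n :=
    hMlim.eventually (lt_mem_nhds (by linarith))
  have hMup : ∀ᶠ n : ℕ in atTop, (M n : ℝ) / n < 2 * t :=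
    hMlim.eventually (gt_mem_nhds (by linarith))
  obtain ⟨N, hN⟩ := eventually_atTop.1
    (((hq_ev.and hMup).and hMpos).and (eventually_gt_atTop 0))
  refine ⟨N, fun n hn ↦ ?_⟩
  obtain ⟨⟨⟨hqn, hMu⟩, hMp⟩, hn0⟩ := hN n hn
  have hn' : (0 : ℝ) < n := by exact_mod_cast hn0
  have hm0 : 0 < (M n : ℝ) := by
    have h := mul_pos (by linarith : (0 : ℝ) < (M n : ℝ) / n) hn'
    rwa [div_mul_cancel₀ _ hn'.ne'] at h
  -- the Lipschitz error of the window sum against `N_n · g n ⌊xn⌋`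
  have hE : |∑ i ∈ Finset.range (M n), g n (⌊x * n⌋ + 1 + i) - (M n : ℝ) * g n ⌊x * n⌋|
      ≤ C' / (n : ℝ) ^ 2 * (M n : ℝ) ^ 2 := by
    refine abs_sum_range_sub_mul_le (by positivity) fun i hi ↦ ?_
    have h1 : ((i : ℕ) : ℤ) + 1 ≤ ((M n : ℕ) : ℤ) := by exact_mod_cast hi
    rw [hMint] at h1
    have hk2 : ⌊x * (n : ℝ)⌋ + 1 + i ≤ ⌊(x + δ₀) * n⌋ := by
      have h2 : ⌊(x + t) * (n : ℝ)⌋ ≤ ⌊(x + δ₀) * n⌋ :=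
        Int.floor_le_floor (mul_le_mul_of_nonneg_right (by linarith) (Nat.cast_nonneg _))
      omega
    have h := hlip n (by omega) ⌊x * n⌋ (⌊x * n⌋ + 1 + i) le_rfl (by omega) hk2
    refine h.trans (le_of_eq ?_)
    push_cast
    ring
  have hkey : (n : ℝ) * g n ⌊x * n⌋
        - (∑ i ∈ Finset.range (M n), g n (⌊x * n⌋ + 1 + i)) / ((M n : ℝ) / n)
      = (n : ℝ) / M n * ((M n : ℝ) * g n ⌊x * n⌋
        - ∑ i ∈ Finset.range (M n), g n (⌊x * n⌋ + 1 + i)) := by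
    have hm0' := hm0.ne'
    have hn'' := hn'.ne'
    field_simp
  have h1 : |(n : ℝ) * g n ⌊x * n⌋
        - (∑ i ∈ Finset.range (M n), g n (⌊x * n⌋ + 1 + i)) / ((M n : ℝ) / n)|
      ≤ C' * ((M n : ℝ) / n) := by
    rw [hkey, abs_mul, abs_of_pos (div_pos hn' hm0), abs_sub_comm]
    calc (n : ℝ) / M n * |∑ i ∈ Finset.range (M n), g n (⌊x * n⌋ + 1 + i) - (M n : ℝ) * g n ⌊x * n⌋|
        ≤ (n : ℝ) / M n * (C' / (n : ℝ) ^ 2 * (M n : ℝ) ^ 2) :=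
          mul_le_mul_of_nonneg_left hE (by positivity)
      _ = C' * ((M n : ℝ) / n) := by
          have hm0' := hm0.ne'
          have hn'' := hn'.ne'
          field_simp
  have h4 : C' * ((M n : ℝ) / n) ≤ τ / 2 := by
    calc C' * ((M n : ℝ) / n) ≤ C' * (2 * t) := mul_le_mul_of_nonneg_left hMu.le hC'0
      _ ≤ τ / 2 := by linarith [htτ']
  -- conclude
  rw [Real.dist_eq, abs_sub_lt_iff]
  rw [abs_le] at h1
  rw [abs_sub_lt_iff] at hqn htsl
  constructor <;> linarith [h1.1, h1.2, hqn.1, hqn.2, htsl.1, htsl.2]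

end Summit.CriticalPhenomena.CardyFormulaZ2.Cruxes.HalfPlaneMarkDensityLaw.SketchLine
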